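import Summits.AtomisticToContinuum.FouriersLaw.Theses.CoercivePulse
import Summits.AtomisticToContinuum.FouriersLaw.Theorems.AbelRegularity.Negative.PoissonMeansOscillate
import Summits.AtomisticToContinuum.FouriersLaw.Theorems.AbelRegularity.Negative.TimeDomainOscillation
import Summits.AtomisticToContinuum.FouriersLaw.Theorems.AbelRegularity.Negative.LacunaryPulseNotTame
import Summits.AtomisticToContinuum.FouriersLaw.Theorems.CageBudgetFeketeHeatVarianceCalculus
import Literature.MathematicalPhysics.KineticTheory.InfiniteChainGoodSetSymmetries

/-!
# Disproof of `AbelRegularity` (crux stmt-AtomisticToContinuum-15384, route CoercivePulse; shared with HoelderEscapeProfile)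
# — findings of the crux disprover (cdisprove), cycle 1, 2026-08-17

VERDICT SO FAR: **no kill; the crux resists for a structural reason** (§0): dynamics rigidity + uniqueness of the
shift-invariant DLR state make EVERY guarded pair `(μ, D)` the canonical one (transfer-operator state, Buttà–Marchioro
flow), so `AbelRegularity` is equivalent (`abelRegularity_iff_witness`, proved below) to ONE statement about THE pinned
anharmonic chain: non-oscillation at `ν ↓ 0` of the Abel/Poisson means of its current spectral measure — the
zero-frequency regularity question, open (BonettoLebowitzReyBellet2000 §7).  No junk state, junk dynamics, junk operator
or degenerate parameter is available: `tsum`/Bochner junk is neutralised by the two convergence hypotheses (which are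
moreover PROVABLE, §0), `𝓝[>] 0` is `NeBot`, `γ` is inert, `T > 0` arbitrary but genuine.

INDEX
* §0 `guard_completion`, `abelRegularity_iff_core`, `abelRegularity_iff_witness` — LOAD-BEARING ANALYSIS, positive half:
  the momentum-reversal, a.e.-shift-covariance, absolute-convergence and Laplace-integrability hypotheses are IDLE
  (consequences of Gibbs + shift-invariance + `PreservesMeasure`), and the `∀ (μ, D)` is decoration (`∃` suffices).
  (Positive-direction helpers: recorded here for the provers, not landable on the Negative lane.)
* §1 LOAD-BEARING ANALYSIS, negative half: the a.e.-CARRIER clause of `PreservesMeasure` is load-bearing —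
  `Negative.abelRegularity_false_without_carrierAE` (LANDED, p150651, refuter-rattack seat): frozen `φ_t = R` witness,
  `C ≡ −c₀ < 0`, `A = −c₀/ν → −∞`.  Re-exported below.  The Gibbs / shift-invariance / measure-preservation clauses
  cannot be shown load-bearing cheaply: dropping any one of them un-pins `(μ, D)` but every explicit non-canonical pair
  we can build (Dirac mass at the equilibrium `σ ≡ 0` with the trivial flow; frozen reversal) either has `C ≡ 0`
  (dichotomy true) or violates TWO clauses at once.
* §2 NATURAL STRENGTHENINGS REFUTED: (i) spectral form — `Negative.not_poissonMeans_dichotomy` (LANDED p150651):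
  Poisson means of a finite positive measure may oscillate (lacunary shells); (ii) time-domain form —
  `Negative.not_abelDichotomy_of_basics` (LANDED: p166965 `Negative/LacunaryPulse.lean` + p167196
  `Negative/TimeDomainOscillation.lean`): a continuous even memory `F` with `|F| ≤ F(0)`, `F → 0`, Laplace-integrable,
  `A ≥ 0` — exactly the OUTPUT of the line's stub S1 — whose Abel means oscillate (`A(ρⁿ/16) ≥ 15/17`,
  `A(ρⁿ/4096) ≤ (1/8)(1−ρ)⁻¹`, `ρ = 2⁻¹⁶`): the lacunary pulse `F(t) = Σₖ ρᵏ(e^{-ρᵏ|t|} − 2⁻⁸e^{-ρᵏ|t|/256})`.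
  (iii) "converge in ℝ" alone (no `+∞` branch) is false at the harmonic member (Drude weight; excluded by `lam, β > 0`,
  not formalisable here — no harmonic infinite-volume dynamics in tree).
* §3 LINE `Sketch` (PICKED): S1–S4 ALL LANDED by the lead (true statements; S2/S4 re-checked on paper before they
  landed); their hypotheses `0 < ∫ψ` (S2 iv) and `b ≤ A` (S4) are load-bearing (`Negative.filterTransfer_false_without_mass`,
  `Negative.monotoneAbelOfSignedMoment_false_without_lowerBound`, LANDED p167196); S3's `F⁻ ∈ L¹` cannot be weakened to decay
  (`Negative.not_abelDichotomy_of_tendsto_zero`, p167196).  S5 `stub_tameFilteredMemory` (the physics stub, the only open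
  one) is about THE chain (by §0) — unassailable cheaply; but its CONCLUSION FAILS VERBATIM for the lacunary pulse for
  EVERY causal filter `ψ` (`Negative.lacunaryPulse_not_tame`, LANDED p167304: landed S2–S4 run contrapositively), with
  `Negative.lacunaryPulse_negPart_not_integrable` and `Negative.lacunaryPulse_iteratedMoment_changes_sign` as unfiltered
  special cases.  So S5 cannot follow from any property `C_T` shares with the pulse (continuity, evenness, `|C| ≤ C(0)`,
  decay, Laplace integrability, `A ≥ 0`; positive type too, unproved remark): its proof must use a chain-specific input
  the pulse lacks (a bound on the number of relaxation scales carrying unit anticorrelation area; LAP at `ω = 0`; an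
  eventual sign).  JOINT SUFFICIENCY: `AbelRegularity_of` is fully proved in the skeleton — no gap.
* §4 NEAR-MISSES / WHY IT RESISTS: a refutation needs lacunary zero-frequency spectral mass of the GENUINE chain; a
  proof needs zero-frequency input beyond positive type (LAP at `ω = 0`, an eventual sign of `C_T`, S5).  Nothing in
  print decides either (BLR2000 §7; Spohn 1991 II.2).  Targets (lead's stuck stubs): none posted yet.
-/

noncomputable section

namespace Summit.AtomisticToContinuum.FouriersLaw.Cruxes.AbelRegularity.Disproof

open MeasureTheory Set Filter Topology
open Literature.MathematicalPhysics.KineticTheory.HeatConduction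
open Summit.AtomisticToContinuum.FouriersLaw.Theorems

/-! ## §0 The crux reduces to the canonical pair: four hypotheses are idle, `∀ (μ, D)` is decoration -/

/-- `AbelRegularity` with the momentum-reversal, a.e.-covariance, absolute-convergence and Laplace-integrability
hypotheses DROPPED (only Gibbs + shift-invariance + `PreservesMeasure` kept). -/
def AbelRegularityCore : Prop :=
  ∀ ω₂ lam β γ : ℝ, 0 < ω₂ → 0 < lam → 0 < β → ∀ T : ℝ, 0 < T → ∀ μ : Measure ChainConfig,
    (pinnedChain ω₂ lam β γ).IsChainGibbsMeasure T μ → IsShiftInvariant μ →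
    ∀ D : InfiniteChainDynamics (pinnedChain ω₂ lam β γ), D.PreservesMeasure μ →
    ((∃ L : ℝ, Tendsto (fun ν : ℝ => ∫ t in Ioi (0:ℝ), Real.exp (-(ν * t)) * D.currentCorrelation μ t)
        (𝓝[>] 0) (𝓝 L)) ∨
      Tendsto (fun ν : ℝ => ∫ t in Ioi (0:ℝ), Real.exp (-(ν * t)) * D.currentCorrelation μ t) (𝓝[>] 0) atTop)

/-- `AbelRegularity` in WITNESS form: for each `(ω₂, lam, β, γ, T)` SOME guarded pair has the Abel dichotomy. -/
def AbelRegularityWitness : Prop :=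
  ∀ ω₂ lam β γ : ℝ, 0 < ω₂ → 0 < lam → 0 < β → ∀ T : ℝ, 0 < T →
    ∃ (μ : Measure ChainConfig) (D : InfiniteChainDynamics (pinnedChain ω₂ lam β γ)),
      (pinnedChain ω₂ lam β γ).IsChainGibbsMeasure T μ ∧ IsShiftInvariant μ ∧ D.PreservesMeasure μ ∧
      ((∃ L : ℝ, Tendsto (fun ν : ℝ => ∫ t in Ioi (0:ℝ), Real.exp (-(ν * t)) * D.currentCorrelation μ t)
          (𝓝[>] 0) (𝓝 L)) ∨
        Tendsto (fun ν : ℝ => ∫ t in Ioi (0:ℝ), Real.exp (-(ν * t)) * D.currentCorrelation μ t) (𝓝[>] 0) atTop)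

/-- **Guard completion.** For the pinned chain, a shift-invariant DLR state `μ` at `T > 0` and ANY `μ`-preserving
dynamics `D`: `μ` is momentum-reversal invariant (uniqueness in the shift-invariant class), `D` is a.e. shift-covariant
(rigidity onto the Buttà–Marchioro flow, which commutes with the shift on its good set), the summed current correlations
converge absolutely and `e^{-νt}C_T ∈ L¹(0,∞)` (landed heat-variance calculus).  So these four hypotheses of the crux are
idle. [folklore] -/
theorem guard_completion {ω₂ lam β : ℝ} (γ : ℝ) (hω : 0 < ω₂) (hl : 0 < lam) (hβ : 0 < β) {T : ℝ} (hT : 0 < T)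
    {μ : Measure ChainConfig} (hG : (pinnedChain ω₂ lam β γ).IsChainGibbsMeasure T μ) (hSI : IsShiftInvariant μ)
    (D : InfiniteChainDynamics (pinnedChain ω₂ lam β γ)) (hP : D.PreservesMeasure μ) :
    μ.map (fun σ : ChainConfig => fun x : ℤ => ((σ x).1, -(σ x).2)) = μ ∧
    (∀ t : ℝ, ∀ᵐ σ ∂μ, D.flow t (shift σ) = shift (D.flow t σ)) ∧
    (∀ t : ℝ, D.HasAbsConvergentCorrelation μ t) ∧
    (∀ ν : ℝ, 0 < ν → IntegrableOn (fun t : ℝ => Real.exp (-(ν * t)) * D.currentCorrelation μ t) (Ioi 0)) := by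
  have hss := OscillatorChain.hasSuperstabilityEstimate_of_isShiftInvariant_pinnedChain γ hω hl.le hβ.le hT hG hSI
  have huniq : ∀ μ₁ μ₂ : Measure ChainConfig,
      (pinnedChain ω₂ lam β γ).IsChainGibbsMeasure T μ₁ → IsShiftInvariant μ₁ →
      (pinnedChain ω₂ lam β γ).HasSuperstabilityEstimate μ₁ →
      (pinnedChain ω₂ lam β γ).IsChainGibbsMeasure T μ₂ → IsShiftInvariant μ₂ →
      (pinnedChain ω₂ lam β γ).HasSuperstabilityEstimate μ₂ → μ₁ = μ₂ :=
    fun μ₁ μ₂ h₁ hS₁ _ h₂ hS₂ _ =>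
      OscillatorChain.eq_of_isChainGibbsMeasure_of_isShiftInvariant_pinnedChain γ hω hl.le hβ.le hT h₁ hS₁ h₂ hS₂
  have hrev : μ.map (fun σ : ChainConfig => fun x : ℤ => ((σ x).1, -(σ x).2)) = μ := by
    have h := OscillatorChain.map_momentumReversalZ_eq_of_regular_unique hG hSI hss huniq
    rw [coe_momentumReversalZ] at h
    exact h
  have hU2 : OscillatorChain.IsEvenPolyOfDegree (pinnedChain ω₂ lam β γ).U 2 :=
    OscillatorChain.pinnedChain_isEvenPolyOfDegree_U β γ hω.le hl
  have hV2 : OscillatorChain.IsEvenPolyOfDegree (pinnedChain ω₂ lam β γ).V 2 :=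
    OscillatorChain.pinnedChain_isEvenPolyOfDegree_V ω₂ lam γ hβ
  have hU0 : ∀ r, 0 ≤ (pinnedChain ω₂ lam β γ).U r := hU2.choose_spec.2.2
  have hV0 : ∀ r, 0 ≤ (pinnedChain ω₂ lam β γ).V r := hV2.choose_spec.2.2
  obtain ⟨D', hcar, -, -, -, -, -, hpres⟩ :=
    OscillatorChain.exists_bmDynamics (P := pinnedChain ω₂ lam β γ) (by norm_num) (by norm_num) hU2 hV2
  have hP' : D'.PreservesMeasure μ := hpres T μ hG hss
  have hrig := HeatVarianceCalculus.CanonicalRigidity.flow_ae_eq_canonical γ hω hl hβ hT hG hSI D D' hP hcar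
  have hmp : MeasurePreserving shift μ μ := ⟨shift_measurable, hSI⟩
  have hcov : ∀ t : ℝ, ∀ᵐ σ ∂μ, D.flow t (shift σ) = shift (D.flow t σ) := by
    intro t
    have h1 : ∀ᵐ σ ∂μ, ∀ t, D.flow t (shift σ) = D'.flow t (shift σ) := hmp.quasiMeasurePreserving.ae hrig
    have h2 := D'.flow_comp_chainShift_ae_of_carrier_eq_bmGood hcar hU0 hV0 hP'.1 t 1
    filter_upwards [hrig, h1, h2] with σ hσ hσ1 hσ2
    have e2 : D'.flow t (shift σ) = shift (D'.flow t σ) := by rw [← chainShift_one]; exact hσ2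
    rw [hσ1 t, e2, hσ t]
  obtain ⟨hAC, -, hV⟩ := HeatVarianceCalculus.CanonicalRigidity.heatVarianceCalculus_proof ω₂ lam β γ hω hl hβ T hT μ
    hG hSI hrev D hP hcov
  exact ⟨hrev, hcov, hAC, fun ν hν => ((hV _ rfl).2 ν hν).1⟩

/-- **`AbelRegularity ↔ AbelRegularityCore`**: the four completed hypotheses are idle. [folklore] -/
theorem abelRegularity_iff_core :
    _root_.Summit.AtomisticToContinuum.FouriersLaw.Theses.CoercivePulse.AbelRegularity ↔ AbelRegularityCore := by
  constructor
  · intro h ω₂ lam β γ hω hl hβ T hT μ hG hSI D hP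
    obtain ⟨hrev, hcov, hAC, hInt⟩ := guard_completion γ hω hl hβ hT hG hSI D hP
    exact h ω₂ lam β γ hω hl hβ T hT μ hG hSI hrev D hP hcov hAC hInt
  · intro h ω₂ lam β γ hω hl hβ T hT μ hG hSI _ D hP _ _ _
    exact h ω₂ lam β γ hω hl hβ T hT μ hG hSI D hP

/-- **`AbelRegularity ↔ AbelRegularityWitness`**: the universal quantifier over guarded pairs is decoration — the
shift-invariant DLR state is unique and any two `μ`-preserving dynamics have the same summed current autocorrelation
(both are the Buttà–Marchioro flow a.e.); and a guarded pair exists (transfer-operator state × BM flow).  So the crux is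
ONE assertion per `(ω₂, lam, β, T)` about THE chain. [folklore] -/
theorem abelRegularity_iff_witness :
    _root_.Summit.AtomisticToContinuum.FouriersLaw.Theses.CoercivePulse.AbelRegularity ↔ AbelRegularityWitness := by
  rw [abelRegularity_iff_core]
  constructor
  · intro h ω₂ lam β γ hω hl hβ T hT
    obtain ⟨μ, hG, hS, hss⟩ :=
      OscillatorChain.exists_isChainGibbsMeasure_shiftInvariant_superstable_pinnedChain γ hω hl.le hβ.le hT
    have hU2 : OscillatorChain.IsEvenPolyOfDegree (pinnedChain ω₂ lam β γ).U 2 :=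
      OscillatorChain.pinnedChain_isEvenPolyOfDegree_U β γ hω.le hl
    have hV2 : OscillatorChain.IsEvenPolyOfDegree (pinnedChain ω₂ lam β γ).V 2 :=
      OscillatorChain.pinnedChain_isEvenPolyOfDegree_V ω₂ lam γ hβ
    obtain ⟨D, -, -, -, -, -, -, hpres⟩ :=
      OscillatorChain.exists_bmDynamics (P := pinnedChain ω₂ lam β γ) (by norm_num) (by norm_num) hU2 hV2
    exact ⟨μ, D, hG, hS, hpres T μ hG hss, h ω₂ lam β γ hω hl hβ T hT μ hG hS D (hpres T μ hG hss)⟩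
  · intro h ω₂ lam β γ hω hl hβ T hT μ₁ hG₁ hS₁ D₁ hP₁
    obtain ⟨μ, D, hG, hS, hP, hdich⟩ := h ω₂ lam β γ hω hl hβ T hT
    obtain rfl : μ₁ = μ :=
      OscillatorChain.eq_of_isChainGibbsMeasure_of_isShiftInvariant_pinnedChain γ hω hl.le hβ.le hT hG₁ hS₁ hG hS
    -- both dynamics are the canonical one a.e., hence have the same summed current autocorrelation
    have hU2 : OscillatorChain.IsEvenPolyOfDegree (pinnedChain ω₂ lam β γ).U 2 :=
      OscillatorChain.pinnedChain_isEvenPolyOfDegree_U β γ hω.le hl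
    have hV2 : OscillatorChain.IsEvenPolyOfDegree (pinnedChain ω₂ lam β γ).V 2 :=
      OscillatorChain.pinnedChain_isEvenPolyOfDegree_V ω₂ lam γ hβ
    obtain ⟨D', hcar, -, -, -, -, -, -⟩ :=
      OscillatorChain.exists_bmDynamics (P := pinnedChain ω₂ lam β γ) (by norm_num) (by norm_num) hU2 hV2
    have hrig₁ := HeatVarianceCalculus.CanonicalRigidity.flow_ae_eq_canonical γ hω hl hβ hT hG₁ hS₁ D₁ D' hP₁ hcar
    have hrig := HeatVarianceCalculus.CanonicalRigidity.flow_ae_eq_canonical γ hω hl hβ hT hG₁ hS₁ D D' hP hcar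
    have hCC : (fun t : ℝ => D₁.currentCorrelation μ₁ t) = fun t : ℝ => D.currentCorrelation μ₁ t := by
      funext t
      unfold InfiniteChainDynamics.currentCorrelation
      refine tsum_congr fun x => integral_congr_ae ?_
      filter_upwards [hrig₁, hrig] with σ h₁ h₂
      rw [h₁ t, h₂ t]
    have e : (fun ν : ℝ => ∫ t in Ioi (0:ℝ), Real.exp (-(ν * t)) * D₁.currentCorrelation μ₁ t) =
        fun ν : ℝ => ∫ t in Ioi (0:ℝ), Real.exp (-(ν * t)) * D.currentCorrelation μ₁ t := by
      funext ν
      simp only [show ∀ t, D₁.currentCorrelation μ₁ t = D.currentCorrelation μ₁ t from fun t => congr_fun hCC t]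
    rw [e]
    exact hdich

/-! ## §1 Load-bearing hypothesis: the a.e.-carrier clause (landed, re-exported) -/

/-- `AbelRegularity` with `D.PreservesMeasure μ` weakened to "every `φ_t` preserves `μ`" (a.e.-carrier clause dropped). -/
def AbelRegularityWithoutCarrierAE : Prop :=
  ∀ ω₂ lam β γ : ℝ, 0 < ω₂ → 0 < lam → 0 < β → ∀ T : ℝ, 0 < T →
    ∀ μ : Measure ChainConfig,
      (pinnedChain ω₂ lam β γ).IsChainGibbsMeasure T μ → IsShiftInvariant μ →
      μ.map (fun σ : ChainConfig => fun x : ℤ => ((σ x).1, -(σ x).2)) = μ →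
      ∀ D : InfiniteChainDynamics (pinnedChain ω₂ lam β γ),
        (∀ t : ℝ, MeasurePreserving (D.flow t) μ μ) →
        (∀ t : ℝ, ∀ᵐ σ ∂μ, D.flow t (shift σ) = shift (D.flow t σ)) →
        (∀ t : ℝ, D.HasAbsConvergentCorrelation μ t) →
        (∀ ν : ℝ, 0 < ν →
          IntegrableOn (fun t : ℝ => Real.exp (-(ν * t)) * D.currentCorrelation μ t) (Ioi 0)) →
        ((∃ L : ℝ, Tendsto (fun ν : ℝ => ∫ t in Ioi (0:ℝ), Real.exp (-(ν * t)) * D.currentCorrelation μ t)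
            (𝓝[>] 0) (𝓝 L)) ∨
          Tendsto (fun ν : ℝ => ∫ t in Ioi (0:ℝ), Real.exp (-(ν * t)) * D.currentCorrelation μ t)
            (𝓝[>] 0) atTop)

/-- **Any proof must use the a.e.-carrier clause of `PreservesMeasure`** (the only clause tying `D.flow` to Newton's
equations): frozen `φ_t = R` witness at `ω₂ = lam = β = γ = T = 1`, `C ≡ −C_T(0) < 0`, `A = −c₀/ν → −∞`.
LANDED as `Negative.abelRegularity_false_without_carrierAE` (p150651). [folklore] -/
theorem abelRegularity_false_without_carrierAE : ¬ AbelRegularityWithoutCarrierAE :=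
  AbelRegularity.Negative.abelRegularity_false_without_carrierAE

/-! ## §2 Natural strengthenings refuted -/

/-- Spectral form (LANDED p150651): Poisson means of a finite positive measure need not have the dichotomy. [folklore] -/
theorem not_poissonMeans_dichotomy :
    ¬ ∀ ρ : Measure ℝ, IsFiniteMeasure ρ →
      ((∃ L : ℝ, Tendsto (fun ν : ℝ => ∫ ω, ν / (ν ^ 2 + ω ^ 2) ∂ρ) (𝓝[>] 0) (𝓝 L)) ∨
          Tendsto (fun ν : ℝ => ∫ ω, ν / (ν ^ 2 + ω ^ 2) ∂ρ) (𝓝[>] 0) atTop) :=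
  AbelRegularity.Negative.not_poissonMeans_dichotomy

/-- Time-domain form (LANDED p166965 + p167196): the basics of S1 — continuity, `|C| ≤ C(0)`, Laplace integrability,
`A ≥ 0` — do not give the Abel dichotomy (lacunary pulse). [folklore] -/
theorem not_abelDichotomy_of_basics :
    ¬ ∀ F : ℝ → ℝ, Continuous F → (∀ t : ℝ, |F t| ≤ F 0) →
      (∀ ν : ℝ, 0 < ν → IntegrableOn (fun t : ℝ => Real.exp (-(ν * t)) * F t) (Ioi 0)) →
      (∀ ν : ℝ, 0 < ν → 0 ≤ ∫ t in Ioi (0:ℝ), Real.exp (-(ν * t)) * F t) →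
      ((∃ L : ℝ, Tendsto (fun ν : ℝ => ∫ t in Ioi (0:ℝ), Real.exp (-(ν * t)) * F t) (𝓝[>] 0) (𝓝 L)) ∨
        Tendsto (fun ν : ℝ => ∫ t in Ioi (0:ℝ), Real.exp (-(ν * t)) * F t) (𝓝[>] 0) atTop) :=
  AbelRegularity.Negative.not_abelDichotomy_of_basics

/-- Decay is not enough either (LANDED p167196): S3's `F⁻ ∈ L¹` cannot be weakened to `F → 0`. [folklore] -/
theorem not_abelDichotomy_of_tendsto_zero :
    ¬ ∀ F : ℝ → ℝ, Continuous F → (∀ t : ℝ, |F t| ≤ F 0) → Tendsto F atTop (𝓝 0) →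
      (∀ ν : ℝ, 0 < ν → 0 ≤ ∫ t in Ioi (0:ℝ), Real.exp (-(ν * t)) * F t) →
      ((∃ L : ℝ, Tendsto (fun ν : ℝ => ∫ t in Ioi (0:ℝ), Real.exp (-(ν * t)) * F t) (𝓝[>] 0) (𝓝 L)) ∨
        Tendsto (fun ν : ℝ => ∫ t in Ioi (0:ℝ), Real.exp (-(ν * t)) * F t) (𝓝[>] 0) atTop) :=
  AbelRegularity.Negative.not_abelDichotomy_of_tendsto_zero

/-! ## §3 Line `Sketch`: load-bearing stub hypotheses and the failure profile of S5 (all LANDED) -/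

/-- S2 (iv): the mass condition `0 < ∫ψ` is load-bearing (p167196). [folklore] -/
example := @AbelRegularity.Negative.filterTransfer_false_without_mass

/-- S4: the lower bound `b ≤ A` is load-bearing in the `W_k ≤ 0` branch (p167196). [folklore] -/
example := @AbelRegularity.Negative.monotoneAbelOfSignedMoment_false_without_lowerBound

/-- S5: its conclusion fails verbatim for the lacunary pulse, for every causal filter (p167304). [folklore] -/
example := @AbelRegularity.Negative.lacunaryPulse_not_tame

/-- S3 on the failure profile: the pulse's anticorrelation has infinite area (p167304). [folklore] -/
example := @AbelRegularity.Negative.lacunaryPulse_negPart_not_integrable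

/-- S4 on the failure profile: every `W_k` of the pulse changes sign beyond every `t₀` (p167304). [folklore] -/
example := @AbelRegularity.Negative.lacunaryPulse_iteratedMoment_changes_sign

/-! ## §4 Targets (lead's stuck stubs): none posted in cycle 1.  Near-misses: none formal — see the module docblock. -/

end Summit.AtomisticToContinuum.FouriersLaw.Cruxes.AbelRegularity.Disproof

end
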